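import Summits.CriticalPhenomena.PercolationContinuityZ3.Theorems.FK.InfiniteVolumeDefs
import Literature.Probability.Percolation.ConstrainedClusters
import HarnessLib

/-!
# FK-continuity transplant, FO-06 (construction half): definitions — the random-cluster specification
# (Grimmett's conditional measures `φ^ξ_{Λ,p,q}`) and DLR random-cluster measures (the class `R_{p,q}`)

Cell `fk-continuity` (bschramm), row FO-06b-6; support file for the FK-continuity transplant
(`--supports stmt-CriticalPhenomena-4575`); builds on p205010 (kernel theorem, internal audit signed;
external expert review pending). Definitions only (plus their unfolding lemmas); the theorems about them
are the companion files `InfiniteVolumeDLRClusters.lean` (combinatorics and measurability of the kernel),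
`InfiniteVolumeDLRLocality.lean` (Grimmett's Lemma (4.39) for regions), `InfiniteVolumeDLRBoxKernel.lean`
(Lemma (4.13), exact, for the box laws) and `InfiniteVolumeDLREquation.lean` (the DLR equation (4.30) for
every box limit `φ^b_{p,q}`, Thm. (4.34)(b)). General dimension `d`.

Grimmett 2006, §4.2 (4.11)–(4.12) and §4.4 Def. (4.29): for a finite region `Λ ⊂ ℤ^d` with edge set
`E_Λ` (the lattice edges with both endpoints in `Λ`, the tree's `edgesIn (zdGraph d) Λ`) and a
configuration `ξ` of `ℤ^d`, the random-cluster measure `φ^ξ_{Λ,p,q}` "on `Λ` with boundary condition `ξ`"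
gives the configuration `ω` (`= ξ` off `E_Λ`) the weight
`p^{|ω ∩ E_Λ|} (1-p)^{|E_Λ ∖ ω|} q^{k(ω,Λ)}`, `k(ω, Λ)` = the number of open clusters of the INFINITE
configuration `ω` that meet `Λ` (so two vertices of `Λ` joined by an open path of `ξ` outside `E_Λ` count
as one cluster: the boundary condition is the PARTITION of `Λ` induced by the connections of `ξ` off
`E_Λ`, of which "free" and "wired" are the two extreme cases).  A probability measure `φ` on `Ω` is a
DLR-random-cluster measure, `φ ∈ R_{p,q}`, if `φ(A | 𝒯_Λ)(ξ) = φ^ξ_{Λ,p,q}(A)` for `φ`-a.e. `ξ`, all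
events `A` and all finite `Λ` (Def. (4.29), eq. (4.30); boxes there, regions here — equivalent, p. 78).

* `meetClusterCount ω S` — `k(ω, S)`: the number of open clusters of `ω` meeting the vertex set `S`
  (`Set.ncard` of the set of connected components of `openGraph ω` hit by `S`).
* `rcCondWeight p q Λ ξ η`, `rcCondPartition p q Λ ξ`, `rcCondProb p q Λ ξ η` — the weight, normalisation
  and probability that `φ^ξ_{Λ,p,q}` gives to the inside pattern `ω ∩ E_Λ = η` (`η ⊆ E_Λ`); they depend
  on `ξ` only through `ξ ∖ E_Λ`.  THE SPECIFICATION KERNEL of the random-cluster model.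
* `rcCondLaw p q Λ ξ` — the measure `φ^ξ_{Λ,p,q}` on `Ω = BondConfig (Site d)` itself: the pattern `η`
  inside, `ξ` outside.
* `IsDLRRandomCluster d p q P` — `P ∈ R_{p,q}` (Def. (4.29)), in the junk-free integrated form
  `∫ φ^ξ_{Λ,p,q}(A) P(dξ) = P(A)` of the tree's `IsGibbsMeasure` (Georgii's Remark (1.24); equivalent to
  (4.30) because `φ^ξ_{Λ,p,q}` is proper and `𝒯_Λ`-measurable in `ξ` — `InfiniteVolumeDLREquation.lean`).
* `exitsBox d m z`, `regionBadEvent Λ m` — the local events of Grimmett's Lemma (4.39) for a region: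
  "`z` is joined inside `Λ_{m+1}` to a site of `Λ_{m+1} ∖ Λ_m`" and `D_m(Λ)` = "off `E_Λ`, two vertices
  of `Λ` both exit `Λ_m` without being joined inside `Λ_m`" (for `Λ = {x,y}`, `E_Λ = {e}` these are the
  events written inline in `InfiniteVolumeOneEdgeDLR*.lean`).

## References

* G. Grimmett, *The Random-Cluster Model*, Springer 2006: §4.2 (4.11)–(4.13), Lemma (4.13); §4.4
  Def. (4.29) eq. (4.30), Thm. (4.31), Thm. (4.34), Lemma (4.39). [Grimmett2006]
* H.-O. Georgii, *Gibbs Measures and Phase Transitions*, 2nd ed. 2011, Def. 1.23 / Rem. 1.24 (the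
  integrated form of the DLR equation). [Georgii2011]
-/

noncomputable section

open MeasureTheory Set Filter
open scoped Topology ENNReal

namespace Summit.CriticalPhenomena.PercolationContinuityZ3.Theorems.FK

open Literature.Probability.Percolation Literature.Probability.LatticeModels

/-! ### The number of open clusters meeting a vertex set -/

section MeetClusterCount

variable {V : Type*}

/-- **`k(ω, S)`**: the number of open clusters of the configuration `ω` that meet the vertex set `S` — the
number of connected components of `openGraph ω` containing a vertex of `S` (`Set.ncard`; for finite `S`
this set of components is finite). Grimmett's `k(ω, Λ)` of (4.12). [cite: Grimmett2006, §4.2 (4.12) (k(ω,Λ))] -/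
def meetClusterCount (ω : BondConfig V) (S : Set V) : ℕ :=
  ((openGraph ω).connectedComponentMk '' S).ncard

/-- `meetClusterCount`, unfolded. [cite: Grimmett2006, §4.2 (4.12)] -/
theorem meetClusterCount_eq (ω : BondConfig V) (S : Set V) :
    meetClusterCount ω S = ((openGraph ω).connectedComponentMk '' S).ncard := rfl

end MeetClusterCount

/-! ### The specification kernel `φ^ξ_{Λ,p,q}` of the random-cluster model on `ℤ^d` -/

section Kernel

variable {d : ℕ}

/-- **The weight of the inside pattern `η ⊆ E_Λ` under the boundary condition `ξ`**:
`p^{|η|} (1-p)^{|E_Λ ∖ η|} q^{k(η ∪ (ξ ∖ E_Λ), Λ)}` (Grimmett 2006, (4.12): the configuration equal to `η`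
on `E_Λ` and to `ξ` off `E_Λ`, weighted by its open clusters meeting `Λ`). Depends on `ξ` only through
`ξ ∖ E_Λ`. [cite: Grimmett2006, §4.2 (4.11)–(4.12)] -/
def rcCondWeight (p q : ℝ) (Λ : Finset (Site d)) (ξ : BondConfig (Site d)) (η : Finset (Sym2 (Site d))) : ℝ :=
  p ^ η.card * (1 - p) ^ (edgesIn (zdGraph d) Λ \ η).card *
    q ^ meetClusterCount ((↑η : Set (Sym2 (Site d))) ∪ (ξ \ ↑(edgesIn (zdGraph d) Λ))) (↑Λ : Set (Site d))

/-- **The normalisation `Z^ξ_{Λ,p,q}`**: the total weight of all inside patterns `η ⊆ E_Λ`. [cite: Grimmett2006, §4.2 (4.12) (Z^ξ_Λ)] -/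
def rcCondPartition (p q : ℝ) (Λ : Finset (Site d)) (ξ : BondConfig (Site d)) : ℝ :=
  ∑ η ∈ (edgesIn (zdGraph d) Λ).powerset, rcCondWeight p q Λ ξ η

/-- **The specification kernel**: `φ^ξ_{Λ,p,q}(ω ∩ E_Λ = η)`, the conditional probability of the inside
pattern `η` given the boundary condition `ξ` (Grimmett 2006, (4.12)); intended for `η ⊆ E_Λ`,
`0 ≤ p ≤ 1`, `q > 0`. [cite: Grimmett2006, §4.2 (4.11)–(4.12)] -/
def rcCondProb (p q : ℝ) (Λ : Finset (Site d)) (ξ : BondConfig (Site d)) (η : Finset (Sym2 (Site d))) : ℝ :=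
  rcCondWeight p q Λ ξ η / rcCondPartition p q Λ ξ

/-- **Grimmett's `φ^ξ_{Λ,p,q}` as a measure on `Ω`**: the law of the configuration equal to a random
inside pattern `η ⊆ E_Λ` (distributed by the kernel `rcCondProb`) on `E_Λ` and to `ξ` off `E_Λ` — a finite
sum of Dirac masses (Grimmett 2006, (4.11)–(4.12)). [cite: Grimmett2006, §4.2 (4.11)–(4.12)] -/
def rcCondLaw (p q : ℝ) (Λ : Finset (Site d)) (ξ : BondConfig (Site d)) : Measure (BondConfig (Site d)) :=
  ∑ η ∈ (edgesIn (zdGraph d) Λ).powerset,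
    ENNReal.ofReal (rcCondProb p q Λ ξ η) •
      Measure.dirac ((↑η : Set (Sym2 (Site d))) ∪ (ξ \ ↑(edgesIn (zdGraph d) Λ)))

variable (d) in
/-- **The outside σ-algebra `𝒯_Λ`** of the region `Λ`: the events depending only on the edges off `E_Λ` —
Mathlib's `cylinderEvents` of the coordinates outside `E_Λ`, read on `BondConfig (Site d) = Set (Sym2 (Site d))`
(the form used in `InfiniteVolumeOutsideSandwich.lean`), given a name so that it is a `MeasurableSpace` on
`BondConfig (Site d)` syntactically. [cite: Grimmett2006, §4.4 (4.30) (the σ-field 𝒯_Λ)] -/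
abbrev outsideEvents (Λ : Finset (Site d)) : MeasurableSpace (BondConfig (Site d)) :=
  cylinderEvents (X := fun _ : Sym2 (Site d) => Prop) (↑(edgesIn (zdGraph d) Λ) : Set (Sym2 (Site d)))ᶜ

variable (d) in
/-- **`P` is a DLR-random-cluster measure on `ℤ^d` with parameters `p, q`** (`P ∈ R_{p,q}`, Grimmett 2006,
Def. (4.29)): `P` is a probability measure and `∫ φ^ξ_{Λ,p,q}(A) P(dξ) = P(A)` for every finite region `Λ`
and every event `A` — the integrated form of the DLR equation (4.30) `P(A | 𝒯_Λ) = φ^·_{Λ,p,q}(A)` a.s.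
(Georgii 2011, Rem. (1.24); the form of the tree's `IsGibbsMeasure`), equivalent to it since `φ^ξ_{Λ,p,q}`
is carried by `{ω = ξ off E_Λ}` and is `𝒯_Λ`-measurable in `ξ`. Grimmett asks (4.30) for boxes `Λ`; for
all finite regions is equivalent (p. 78) and is what is proved for the limits `φ^b_{p,q}`. [cite: Grimmett2006, Def. (4.29) eq. (4.30)] -/
structure IsDLRRandomCluster (p q : ℝ) (P : Measure (BondConfig (Site d))) : Prop where
  /-- `P` is a probability measure. -/
  isProbabilityMeasure : IsProbabilityMeasure P
  /-- The DLR equation, integrated form: `∫ φ^ξ_{Λ,p,q}(A) P(dξ) = P(A)`. -/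
  lintegral_rcCondLaw_eq : ∀ (Λ : Finset (Site d)) ⦃A : Set (BondConfig (Site d))⦄, MeasurableSet A →
    ∫⁻ ξ, rcCondLaw p q Λ ξ A ∂P = P A

/-- `rcCondWeight`, unfolded. [cite: Grimmett2006, §4.2 (4.12)] -/
theorem rcCondWeight_eq (p q : ℝ) (Λ : Finset (Site d)) (ξ : BondConfig (Site d)) (η : Finset (Sym2 (Site d))) :
    rcCondWeight p q Λ ξ η = p ^ η.card * (1 - p) ^ (edgesIn (zdGraph d) Λ \ η).card *
      q ^ meetClusterCount ((↑η : Set (Sym2 (Site d))) ∪ (ξ \ ↑(edgesIn (zdGraph d) Λ))) (↑Λ : Set (Site d)) :=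
  rfl

/-- `rcCondPartition`, unfolded. [cite: Grimmett2006, §4.2 (4.12)] -/
theorem rcCondPartition_eq (p q : ℝ) (Λ : Finset (Site d)) (ξ : BondConfig (Site d)) :
    rcCondPartition p q Λ ξ = ∑ η ∈ (edgesIn (zdGraph d) Λ).powerset, rcCondWeight p q Λ ξ η := rfl

/-- `rcCondProb`, unfolded. [cite: Grimmett2006, §4.2 (4.12)] -/
theorem rcCondProb_eq (p q : ℝ) (Λ : Finset (Site d)) (ξ : BondConfig (Site d)) (η : Finset (Sym2 (Site d))) :
    rcCondProb p q Λ ξ η = rcCondWeight p q Λ ξ η / rcCondPartition p q Λ ξ := rfl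

/-- `rcCondLaw`, unfolded. [cite: Grimmett2006, §4.2 (4.11)–(4.12)] -/
theorem rcCondLaw_eq (p q : ℝ) (Λ : Finset (Site d)) (ξ : BondConfig (Site d)) :
    rcCondLaw p q Λ ξ = ∑ η ∈ (edgesIn (zdGraph d) Λ).powerset,
      ENNReal.ofReal (rcCondProb p q Λ ξ η) •
        Measure.dirac ((↑η : Set (Sym2 (Site d))) ∪ (ξ \ ↑(edgesIn (zdGraph d) Λ))) := rfl

end Kernel

/-! ### The local events of Lemma (4.39) for a region -/

section BadEvent

variable (d : ℕ) in
/-- **The exit event** `{z is joined inside Λ_{m+1} to a site of Λ_{m+1} ∖ Λ_m}` (an open path from `z`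
leaves the box `Λ_m`; read inside `Λ_{m+1}` it is a local event). [cite: Grimmett2006, Lemma (4.39) (the events D_{Λ,Δ})] -/
def exitsBox (m : ℕ) (z : Site d) : Set (BondConfig (Site d)) :=
  {ω | ∃ c ∈ box d (m + 1), c ∉ box d m ∧
    ω ∈ openConnVia (withinGraph ⊤ (↑(box d (m + 1)) : Set (Site d))) z c}

variable {d : ℕ}

/-- Membership in `exitsBox`. [cite: Grimmett2006, Lemma (4.39)] -/
theorem mem_exitsBox_iff {m : ℕ} {z : Site d} {ω : BondConfig (Site d)} :
    ω ∈ exitsBox d m z ↔ ∃ c ∈ box d (m + 1), c ∉ box d m ∧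
      ω ∈ openConnVia (withinGraph ⊤ (↑(box d (m + 1)) : Set (Site d))) z c := Iff.rfl

/-- **The bad event `D_m(Λ)` of Lemma (4.39) for the region `Λ`**: in the configuration OFF `E_Λ`, some
two vertices `u, v` of `Λ` both exit the box `Λ_m` but are not joined inside `Λ_m` (Grimmett's `D_{Λ,Δ}`
with `Δ = Λ_m`, read inside `Λ_{m+1}` so that it is a local event). Off `D_m(Λ)` the boundary condition
that any configuration induces on `Λ` is already determined inside `Λ_m`. [cite: Grimmett2006, Lemma (4.39) eq. (4.40) (D_{Λ,Δ})] -/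
def regionBadEvent (Λ : Finset (Site d)) (m : ℕ) : Set (BondConfig (Site d)) :=
  ⋃ u ∈ Λ, ⋃ v ∈ Λ, (fun ω : BondConfig (Site d) => ω \ ↑(edgesIn (zdGraph d) Λ)) ⁻¹'
    (exitsBox d m u ∩ exitsBox d m v ∩ (openConnVia (withinGraph ⊤ (↑(box d m) : Set (Site d))) u v)ᶜ)

/-- Membership in `regionBadEvent`. [cite: Grimmett2006, Lemma (4.39) eq. (4.40)] -/
theorem mem_regionBadEvent_iff {Λ : Finset (Site d)} {m : ℕ} {ω : BondConfig (Site d)} :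
    ω ∈ regionBadEvent Λ m ↔ ∃ u ∈ Λ, ∃ v ∈ Λ,
      ω \ ↑(edgesIn (zdGraph d) Λ) ∈ exitsBox d m u ∧ ω \ ↑(edgesIn (zdGraph d) Λ) ∈ exitsBox d m v ∧
        ω \ ↑(edgesIn (zdGraph d) Λ) ∉ openConnVia (withinGraph ⊤ (↑(box d m) : Set (Site d))) u v := by
  simp only [regionBadEvent, Set.mem_iUnion, Set.mem_preimage, Set.mem_inter_iff, Set.mem_compl_iff,
    exists_prop, and_assoc]

end BadEvent

end Summit.CriticalPhenomena.PercolationContinuityZ3.Theorems.FK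

end
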